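import Literature.AlgebraicGeometry.Frobenioids.BirationalizationPullbackFactorization
import Literature.AlgebraicGeometry.Frobenioids.BiratFrobeniusFactor
import Literature.AlgebraicGeometry.Frobenioids.BiratLocalization
import Literature.AlgebraicGeometry.Frobenioids.ModelFrobenioidComparison
import Literature.AlgebraicGeometry.Frobenioids.FrTrFrobenioid
import HarnessLib

/-!
# Frobenioids I, Proposition 4.4 (ii) (author's 2024 correction (29)(i)): the birationalization
# `C^birat → F_{0_D}` of a Frobenioid of isotropic and birationally Frobenius-normalized type IS A
# FROBENIOID

Mochizuki, *The geometry of Frobenioids I: the general theory*, Kyushu J. Math. **62** (2008)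
293–400, §4, Proposition 4.4 (ii), kurims text p. 83 [cite: MochizukiFrdI2008, Prop. 4.4 (ii) p.83]
("The functor `C^birat → F_{0_D}` of (i) determines a structure of Frobenioid of group-like type on
`C^birat`"), in the author's CORRECTED form (*Comments on [FrdI]*, January 2024, (29)(i)–(ii), comments
PDF p. 5): "The functor `C^birat → F_{0_D}` of (i) determines a structure of pre-Frobenioid of group-like
type on `C^birat`. … Suppose, further, that `C` is of birationally Frobenius-normalized type [cf.
Definition 4.5, (i), below]. Then the pre-Frobenioid `C^birat` is a Frobenioid" — "a routine exercise"
given the dictionary of Prop. 4.4 (iv); "[in the context of the verification of Definition 1.3, (iii),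
(c), we observe … that every object of `(C^istr)^birat` is Frobenius-trivial [cf. Definition 1.3, (i),
(a), (b); Proposition 1.4, (i)], and that any group `G` such `(α·β)² = α²·β²` for all `α, β ∈ G` is
abelian.]"

PROOF-ONLY file (abc-iut cell, L1 deep row W14 `BiratIsFrobenioid`, seat abc-iut-w5-d227), over THE
birationalization of abc-iut-L6-t8 (`Birat F hF hsq`, `toBirat`, `Birat.toElemZero`), the Prop. 4.4 (iv) /
4.8 (i) dictionary (L6-t8 / L6-t6 / L6-t20 / w5-d004) and abc-iut-L6-t20's
`BirationalizationPullbackFactorization.lean` (Def. 1.3 (i), (ii), (iv) for `C^birat`, used BY NAME).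
STAGE 1 = the ISOTROPIC case — the case the cell consumes (`C^istr`: hypothesis `hB` of
`UnitTrivializationFrobeniusCompact.lean`; Cor. 4.11 (ii) over isotropic `C_i`, print p. 92 l. 1–8,
comments (29)(v)). `Birat.isPreFrobenioid` holds for EVERY Frobenioid (`0_D` divisorial; `C^birat`
connected, totally epimorphic by abc-iut-L1-t10's `Birat.epi`). For `C` isotropic: co-angular pre-steps of
`C^birat` = isomorphisms; **every object of `C^birat` is Frobenius-trivial** (`isFrobeniusTrivial_obj`, Def.
1.3 (i)(a)(b) of `C`), hence, under birational Frobenius-normalization, **`O^▷(X^birat)` is commutative**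
(`endSubmonoid_comm`, the author's `(αβ)² = α²β²` argument — the ONLY use of normalization); Def. 1.3
(iii)(c) = conjugation by the invertible co-angular pre-step, its dependence on `Base(φ)` alone being
exactly that commutativity; (iii)(a)(b)(d), (v), (vi), (vii) are immediate. Main results:
**`PreFrobenioid.Birat.isFrobenioid`**, `isFrobenioid_of_isFrobenioid` (`hsq` discharged, L6-t6),
`isFrobenioid_of_isOfModelType` (L6-t8's Def. 4.5 (i)). STAGE 2 (non-isotropic `C`) is NOT treated. No
definitions; no statement of the paper is strengthened; nothing here concerns the disputed parts of IUT.
-/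

namespace Literature.AlgebraicGeometry.Frobenioids

open CategoryTheory Opposite

universe w v v' u u'

namespace PreFrobenioid

namespace Birat

variable {D : Type u} [Category.{v} D] {Φ : Dᵒᵖ ⥤ CommMonCat.{w}}
  {C : Type u'} [Category.{v'} C] {F : C ⥤ ElemFrobenioid Φ}
  {hF : IsFrobenioid F} {hsq : HasBiratSquares F}

/-! ### `C^birat → F_{0_D}` is a pre-Frobenioid (every Frobenioid `C`) -/

/-- `C^birat` is connected: `C → C^birat` maps zigzags to zigzags. [cite: MochizukiFrdI2008, Prop. 4.4 (ii) p.83] -/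
theorem isGraphConnected (hF : IsFrobenioid F) (hsq : HasBiratSquares F) :
    IsGraphConnected (Birat F hF hsq) := by
  obtain ⟨⟨A⟩, hz⟩ := hF.isPreFrobenioid.isGraphConnected
  refine ⟨⟨(toBirat F hF hsq).obj A⟩, fun X Y => ?_⟩
  exact zigzag_obj_of_zigzag (toBirat F hF hsq) (hz X.out Y.out)


/-- `C^birat` is totally epimorphic (abc-iut-L1-t10's `Birat.epi`). [cite: MochizukiFrdI2008, Prop. 4.4 (ii) p.83] -/
theorem isTotallyEpimorphic (hF : IsFrobenioid F) (hsq : HasBiratSquares F) :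
    IsTotallyEpimorphic (Birat F hF hsq) :=
  ⟨fun f => Birat.epi hF hsq f⟩

/-- **[FrdI] Prop. 4.4 (ii), first sentence of the 2024 corrected statement**: "The functor
`C^birat → F_{0_D}` of (i) determines a structure of pre-Frobenioid [of group-like type] on `C^birat`" —
`0_D` is a divisorial monoid on `D`, and `C^birat` is connected and totally epimorphic (EVERY Frobenioid `C`).
[cite: MochizukiFrdI2008, Prop. 4.4 (ii) p.83] -/
theorem isPreFrobenioid (hF : IsFrobenioid F) (hsq : HasBiratSquares F) :
    IsPreFrobenioid (zeroMonoid D) (toElemZero hF hsq) where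
  isMonoidOn := isMonoidOn_zeroMonoid
  isDivisorial := isDivisorial_zeroMonoid
  isGraphConnected_base := hF.isPreFrobenioid.isGraphConnected_base
  isTotallyEpimorphic_base := hF.isPreFrobenioid.isTotallyEpimorphic_base
  isGraphConnected := isGraphConnected hF hsq
  isTotallyEpimorphic := isTotallyEpimorphic hF hsq

/-! ### Dictionary complements for `C` of isotropic type -/

/-- For `C` of isotropic type, the co-angular pre-steps of `C^birat` are exactly the isomorphisms.
[cite: MochizukiFrdI2008, Prop. 4.8 (i) p.88] -/
theorem isCoAngularPreStep_iff_isIso (hiso : IsOfIsotropicType F) {X Y : Birat F hF hsq} (ψ : X ⟶ Y) :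
    IsCoAngularPreStep (toElemZero hF hsq) ψ ↔ IsIso ψ :=
  ⟨fun h => isIso_of_isPreStep hiso ψ h.2, fun h => by
    haveI := h
    exact ⟨isCoAngular hiso ψ, isPreStep_of_isIso (toElemZero hF hsq) ψ⟩⟩

/-- For `C` of isotropic type, every element of `O^▷(X^birat)` (a base-identity linear endomorphism,
hence a pre-step) is an isomorphism of `C^birat`. [cite: MochizukiFrdI2008, Prop. 4.8 (i) p.88] -/
theorem isIso_of_mem_endSubmonoid (hiso : IsOfIsotropicType F) {X : Birat F hF hsq} {a : End X}
    (ha : a ∈ endSubmonoid (toElemZero hF hsq) X) : IsIso (show X ⟶ X from a) := by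
  refine isIso_of_isPreStep hiso _ ⟨ha.2, ?_⟩
  change IsIso (Base (toElemZero hF hsq) (show X ⟶ X from a))
  rw [show Base (toElemZero hF hsq) (show X ⟶ X from a) = 𝟙 _ from ha.1]
  infer_instance

/-- Frobenius-triviality is invariant under isomorphisms of `C^birat` (`C` of isotropic type: the
conjugate of a base-identity Frobenius-type endomorphism is again one, Frobenius type being
"base-isomorphism" in `C^birat`). [cite: MochizukiFrdI2008, Def. 1.2 (iv) p.22] -/
theorem isFrobeniusTrivial_of_iso (hiso : IsOfIsotropicType F) {X Y : Birat F hF hsq} (e : X ≅ Y)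
    (hX : IsFrobeniusTrivial (toElemZero hF hsq) X) : IsFrobeniusTrivial (toElemZero hF hsq) Y := by
  obtain ⟨ζ, hζ⟩ := hX
  refine ⟨(endConj e).comp ζ, fun n => ?_⟩
  obtain ⟨hn, hb, hft⟩ := hζ n
  have hb' : Base (toElemZero hF hsq) (show X ⟶ X from ζ n) = 𝟙 _ := hb
  refine ⟨?_, ?_, ?_⟩
  · show degFr (toElemZero hF hsq) (e.inv ≫ (show X ⟶ X from ζ n) ≫ e.hom) = n
    rw [degFr_comp, degFr_comp, hn,
      show degFr (toElemZero hF hsq) e.inv = 1 from isLinear_of_isIso (toElemZero hF hsq) e.inv,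
      show degFr (toElemZero hF hsq) e.hom = 1 from isLinear_of_isIso (toElemZero hF hsq) e.hom,
      one_mul, mul_one]
  · show Base (toElemZero hF hsq) (e.inv ≫ (show X ⟶ X from ζ n) ≫ e.hom) = 𝟙 _
    rw [base_comp, base_comp, hb', Category.id_comp, ← base_comp, e.inv_hom_id, base_id]
  · exact (isFrobeniusType_iff_isBaseIso hiso _).mpr
      (IsBaseIso.comp (toElemZero hF hsq) (isBaseIso_of_isIso (toElemZero hF hsq) e.inv)
        (IsBaseIso.comp (toElemZero hF hsq) hft.2 (isBaseIso_of_isIso (toElemZero hF hsq) e.hom)))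

/-- For `C` of isotropic type, a pre-step of `C` becomes an isomorphism of `C^birat` (Prop. 1.4 (i):
pre-steps of `C` are co-angular; Prop. 4.4 (iv)). [cite: MochizukiFrdI2008, Prop. 4.8 (i) p.88] -/
theorem isIso_toBirat_map_of_isPreStep (hiso : IsOfIsotropicType F) {A B : C} {φ : A ⟶ B}
    (hφ : IsPreStep F φ) : IsIso ((toBirat F hF hsq).map φ) :=
  toBirat_inverts hF hsq φ (isCoAngularPreStep_of_isotropic hiso hφ)

/-- **"Every object of `(C^istr)^birat` is Frobenius-trivial"** (author's comment (29)(ii), "[cf. Definition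
1.3, (i), (a), (b); Proposition 1.4, (i)]"): `X^birat` is joined to the image of a Frobenius-trivial object
over `Base(X)` by the images of two pre-steps, isomorphisms of `C^birat`. [cite: MochizukiFrdI2008, Prop. 4.4 (ii) p.83] -/
theorem isFrobeniusTrivial_obj (hiso : IsOfIsotropicType F) (X : Birat F hF hsq) :
    IsFrobeniusTrivial (toElemZero hF hsq) X := by
  obtain ⟨A₀, hA₀, ⟨i⟩⟩ := hF.i_a (baseObj F X.out)
  obtain ⟨Z, φ, ψ, hφ, hψ, -⟩ := hF.i_b A₀ X.out i
  haveI := isIso_toBirat_map_of_isPreStep (hF := hF) (hsq := hsq) hiso hφ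
  haveI := isIso_toBirat_map_of_isPreStep (hF := hF) (hsq := hsq) hiso hψ
  have e : (toBirat F hF hsq).obj A₀ ≅ (toBirat F hF hsq).obj X.out :=
    (asIso ((toBirat F hF hsq).map φ)).symm ≪≫ asIso ((toBirat F hF hsq).map ψ)
  exact isFrobeniusTrivial_of_iso hiso e (Birat.isFrobeniusTrivial hiso hA₀)

/-- **Birational Frobenius-normalization makes `O^▷(X^birat)` commutative** (`C` of isotropic and
birationally Frobenius-normalized type) — the author's 2024 argument for Def. 1.3 (iii)(c): with `φ` a
base-identity endomorphism of `X^birat` of Frobenius degree `2` (Frobenius-triviality) and `α, β ∈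
O^▷(X^birat)`, normalization gives `(αβ)² = α²β²` after cancelling the epimorphism `φ`, and "any group `G`
such that `(α·β)² = α²·β²` for all `α, β ∈ G` is abelian". [cite: MochizukiFrdI2008, Prop. 4.4 (ii) p.83] -/
theorem endSubmonoid_comm (hiso : IsOfIsotropicType F)
    (hbfn : ∀ A : C, IsBiratFrobeniusNormalized F hF hsq A) {X : Birat F hF hsq}
    (a b : endSubmonoid (toElemZero hF hsq) X) : a * b = b * a := by
  obtain ⟨ζ, hζ⟩ := isFrobeniusTrivial_obj (hF := hF) (hsq := hsq) hiso X
  obtain ⟨h2, hb2, -⟩ := hζ 2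
  -- normalization at `X = (X.out)^birat` for `C^birat → F_{Φ^gp}` (same bases and degrees as `→ F_{0_D}`)
  have hN : ∀ c : End X, c ∈ endSubmonoid (toElemZero hF hsq) X →
      End.asHom (ζ 2) ≫ End.asHom c ≫ End.asHom c = End.asHom c ≫ End.asHom (ζ 2) := by
    intro c hc
    have h : End.asHom (ζ 2) ≫
        End.asHom (c ^ ((degFr (toElemGp hF hsq) (End.asHom (ζ 2)) : ℕ+) : ℕ)) =
        End.asHom c ≫ End.asHom (ζ 2) := hbfn X.out (End.asHom (ζ 2)) hb2 c hc
    have hdeg : degFr (toElemGp hF hsq) (End.asHom (ζ 2)) = 2 := h2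
    rw [hdeg] at h
    have hc2 : End.asHom (c ^ ((2 : ℕ+) : ℕ)) = End.asHom c ≫ End.asHom c := by
      change c ^ 2 = c * c
      exact pow_two c
    rw [hc2] at h
    exact h
  haveI : Epi (End.asHom (ζ 2)) := Birat.epi hF hsq _
  haveI : IsIso (End.asHom a.1) := isIso_of_mem_endSubmonoid hiso a.2
  haveI : IsIso (End.asHom b.1) := isIso_of_mem_endSubmonoid hiso b.2
  have ha := hN a.1 a.2
  have hb := hN b.1 b.2
  have hab : End.asHom (ζ 2) ≫ (End.asHom b.1 ≫ End.asHom a.1) ≫ (End.asHom b.1 ≫ End.asHom a.1) =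
      (End.asHom b.1 ≫ End.asHom a.1) ≫ End.asHom (ζ 2) :=
    hN (a.1 * b.1) (Submonoid.mul_mem _ a.2 b.2)
  apply Subtype.ext
  change End.asHom b.1 ≫ End.asHom a.1 = End.asHom a.1 ≫ End.asHom b.1
  have e1 : End.asHom (ζ 2) ≫ End.asHom b.1 ≫ End.asHom a.1 ≫ End.asHom b.1 ≫ End.asHom a.1 =
      End.asHom (ζ 2) ≫ End.asHom b.1 ≫ End.asHom b.1 ≫ End.asHom a.1 ≫ End.asHom a.1 := by
    calc End.asHom (ζ 2) ≫ End.asHom b.1 ≫ End.asHom a.1 ≫ End.asHom b.1 ≫ End.asHom a.1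
        = (End.asHom b.1 ≫ End.asHom a.1) ≫ End.asHom (ζ 2) := by
          simpa only [Category.assoc] using hab
      _ = End.asHom b.1 ≫ End.asHom (ζ 2) ≫ End.asHom a.1 ≫ End.asHom a.1 := by
          rw [Category.assoc, ← ha]
      _ = (End.asHom (ζ 2) ≫ End.asHom b.1 ≫ End.asHom b.1) ≫ End.asHom a.1 ≫ End.asHom a.1 := by
          rw [← Category.assoc, ← hb]
      _ = _ := by simp only [Category.assoc]
  have e2 := (cancel_epi (End.asHom (ζ 2))).mp e1
  have e3 := (cancel_epi (End.asHom b.1)).mp e2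
  have e4 : (End.asHom a.1 ≫ End.asHom b.1) ≫ End.asHom a.1 =
      (End.asHom b.1 ≫ End.asHom a.1) ≫ End.asHom a.1 := by
    simpa only [Category.assoc] using e3
  exact ((cancel_mono (End.asHom a.1)).mp e4).symm

/-! ### Definition 1.3 (iii) for `C^birat` -/

/-- Def. 1.3 (iii)(c) for `C^birat` (`C` isotropic): a co-angular pre-step `φ : A → B` is invertible, and
conjugation by it is the required bijection `O^▷(A) ⥲ O^▷(B)` with `β ∘ φ = φ ∘ α`.
[cite: MochizukiFrdI2008, Def. 1.3 (iii) p.24] -/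
theorem birat_iii_c (hiso : IsOfIsotropicType F) {A B : Birat F hF hsq} (φ : A ⟶ B)
    (hφ : IsCoAngularPreStep (toElemZero hF hsq) φ) :
    ∃ e : endSubmonoid (toElemZero hF hsq) A ≃* endSubmonoid (toElemZero hF hsq) B,
      ∀ α : endSubmonoid (toElemZero hF hsq) A,
        φ ≫ (show B ⟶ B from (e α).1) = (show A ⟶ A from α.1) ≫ φ := by
  haveI : IsIso φ := (isCoAngularPreStep_iff_isIso hiso φ).mp hφ
  -- conjugation preserves "base-identity and linear"
  have hconj : ∀ {P Q : Birat F hF hsq} (e : P ≅ Q) (a : End P),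
      a ∈ endSubmonoid (toElemZero hF hsq) P → e.conj a ∈ endSubmonoid (toElemZero hF hsq) Q := by
    intro P Q e a ha
    rw [Iso.conj_apply]
    refine ⟨?_, ?_⟩
    · change Base (toElemZero hF hsq) (e.inv ≫ End.asHom a ≫ e.hom) = 𝟙 _
      rw [base_comp, base_comp, show Base (toElemZero hF hsq) (End.asHom a) = 𝟙 _ from ha.1,
        Category.id_comp, ← base_comp, e.inv_hom_id, base_id]
    · change degFr (toElemZero hF hsq) (e.inv ≫ End.asHom a ≫ e.hom) = 1
      rw [degFr_comp, degFr_comp, show degFr (toElemZero hF hsq) (End.asHom a) = 1 from ha.2,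
        show degFr (toElemZero hF hsq) e.inv = 1 from isLinear_of_isIso (toElemZero hF hsq) e.inv,
        show degFr (toElemZero hF hsq) e.hom = 1 from isLinear_of_isIso (toElemZero hF hsq) e.hom,
        one_mul, one_mul]
  refine ⟨{ toFun := fun a => ⟨(asIso φ).conj a.1, hconj (asIso φ) a.1 a.2⟩
            invFun := fun b => ⟨(asIso φ).symm.conj b.1, hconj (asIso φ).symm b.1 b.2⟩
            left_inv := fun a => Subtype.ext (by simp)
            right_inv := fun b => Subtype.ext (by simp)
            map_mul' := fun a b => Subtype.ext (map_mul _ _ _) }, fun a => ?_⟩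
  change φ ≫ End.asHom ((asIso φ).conj a.1) = End.asHom a.1 ≫ φ
  rw [Iso.conj_apply]
  change φ ≫ (asIso φ).inv ≫ End.asHom a.1 ≫ (asIso φ).hom = End.asHom a.1 ≫ φ
  rw [asIso_inv, asIso_hom, IsIso.hom_inv_id_assoc]

/-- Def. 1.3 (iii)(c), "depends only on `Base(φ)`", for `C^birat` (`C` isotropic and birationally
Frobenius-normalized): two invertible `φ, φ′ : A → B` with the same base differ by
`u := φ⁻¹ ≫ φ′ ∈ O^×(B^birat)`, and the two conjugates of `α` differ by conjugation by `u`, which is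
trivial because `O^▷(B^birat)` is commutative (`endSubmonoid_comm`). [cite: MochizukiFrdI2008, Def. 1.3 (iii) p.24] -/
theorem birat_iii_c_base (hiso : IsOfIsotropicType F)
    (hbfn : ∀ A : C, IsBiratFrobeniusNormalized F hF hsq A) {A B : Birat F hF hsq} (φ φ' : A ⟶ B)
    (hφ : IsCoAngularPreStep (toElemZero hF hsq) φ) (hφ' : IsCoAngularPreStep (toElemZero hF hsq) φ')
    (hb : Base (toElemZero hF hsq) φ = Base (toElemZero hF hsq) φ')
    (α : endSubmonoid (toElemZero hF hsq) A) (β β' : endSubmonoid (toElemZero hF hsq) B)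
    (h : φ ≫ (show B ⟶ B from β.1) = (show A ⟶ A from α.1) ≫ φ)
    (h' : φ' ≫ (show B ⟶ B from β'.1) = (show A ⟶ A from α.1) ≫ φ') : β = β' := by
  haveI : IsIso φ := (isCoAngularPreStep_iff_isIso hiso φ).mp hφ
  haveI : IsIso φ' := (isCoAngularPreStep_iff_isIso hiso φ').mp hφ'
  -- `u := φ⁻¹ ≫ φ'` lies in `O^▷(B)`
  have hu : (inv φ ≫ φ' : End B) ∈ endSubmonoid (toElemZero hF hsq) B := by
    refine ⟨?_, ?_⟩
    · change Base (toElemZero hF hsq) (inv φ ≫ φ') = 𝟙 _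
      rw [base_comp, ← hb, ← base_comp, IsIso.inv_hom_id, base_id]
    · change degFr (toElemZero hF hsq) (inv φ ≫ φ') = 1
      rw [degFr_comp, show degFr (toElemZero hF hsq) (inv φ) = 1 from isLinear_of_isIso _ _,
        show degFr (toElemZero hF hsq) φ' = 1 from isLinear_of_isIso _ _, one_mul]
  have hcomm := endSubmonoid_comm hiso hbfn β ⟨inv φ ≫ φ', hu⟩
  have hcomm' : (inv φ ≫ φ') ≫ End.asHom β.1 = End.asHom β.1 ≫ (inv φ ≫ φ') :=
    congrArg Subtype.val hcomm
  apply Subtype.ext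
  change End.asHom β.1 = End.asHom β'.1
  have e1 : End.asHom β.1 = inv φ ≫ End.asHom α.1 ≫ φ := by
    rw [← cancel_epi φ, IsIso.hom_inv_id_assoc]; exact h
  have e2 : End.asHom β'.1 = inv φ' ≫ End.asHom α.1 ≫ φ' := by
    rw [← cancel_epi φ', IsIso.hom_inv_id_assoc]; exact h'
  -- `β' = u⁻¹ ≫ β ≫ u = β`
  have e3 : End.asHom α.1 = φ ≫ End.asHom β.1 ≫ inv φ := by
    rw [e1]
    simp only [Category.assoc, IsIso.hom_inv_id_assoc, IsIso.hom_inv_id, Category.comp_id]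
  have hc : End.asHom β.1 ≫ inv φ ≫ φ' = inv φ ≫ φ' ≫ End.asHom β.1 := by
    simpa only [Category.assoc] using hcomm'.symm
  calc End.asHom β.1
      = inv φ' ≫ φ' ≫ End.asHom β.1 := by simp
    _ = inv φ' ≫ φ ≫ (inv φ ≫ φ' ≫ End.asHom β.1) := by simp
    _ = inv φ' ≫ φ ≫ (End.asHom β.1 ≫ inv φ ≫ φ') := by rw [hc]
    _ = inv φ' ≫ (φ ≫ End.asHom β.1 ≫ inv φ) ≫ φ' := by simp only [Category.assoc]
    _ = inv φ' ≫ End.asHom α.1 ≫ φ' := by rw [← e3]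
    _ = End.asHom β'.1 := e2.symm

/-- Def. 1.3 (iii)(d), coslice, full, for `C^birat` (`C` isotropic): co-angular pre-steps under `A` are
isomorphisms, so `φ′ = φ ≫ (φ⁻¹ ≫ φ′)`. [cite: MochizukiFrdI2008, Def. 1.3 (iii) p.24] -/
theorem birat_iii_d_under_full (hiso : IsOfIsotropicType F) {A B B' : Birat F hF hsq} (φ : A ⟶ B)
    (φ' : A ⟶ B') (hφ : IsCoAngularPreStep (toElemZero hF hsq) φ)
    (hφ' : IsCoAngularPreStep (toElemZero hF hsq) φ') :
    ∃ f : B ⟶ B', IsCoAngularPreStep (toElemZero hF hsq) f ∧ φ ≫ f = φ' := by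
  haveI : IsIso φ := (isCoAngularPreStep_iff_isIso hiso φ).mp hφ
  haveI : IsIso φ' := (isCoAngularPreStep_iff_isIso hiso φ').mp hφ'
  exact ⟨inv φ ≫ φ', (isCoAngularPreStep_iff_isIso hiso _).mpr inferInstance, by simp⟩

/-- Def. 1.3 (iii)(d), slice, full, for `C^birat` (`C` isotropic). [cite: MochizukiFrdI2008, Def. 1.3 (iii) p.24] -/
theorem birat_iii_d_over_full (hiso : IsOfIsotropicType F) {A B B' : Birat F hF hsq} (ψ : B ⟶ A)
    (ψ' : B' ⟶ A) (hψ : IsCoAngularPreStep (toElemZero hF hsq) ψ)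
    (hψ' : IsCoAngularPreStep (toElemZero hF hsq) ψ') :
    ∃ g : B ⟶ B', IsCoAngularPreStep (toElemZero hF hsq) g ∧ g ≫ ψ' = ψ := by
  haveI : IsIso ψ := (isCoAngularPreStep_iff_isIso hiso ψ).mp hψ
  haveI : IsIso ψ' := (isCoAngularPreStep_iff_isIso hiso ψ').mp hψ'
  exact ⟨ψ ≫ inv ψ', (isCoAngularPreStep_iff_isIso hiso _).mpr inferInstance, by simp⟩

/-! ### Definition 1.3 (v), (vi), (vii) for `C^birat` -/

/-- Def. 1.3 (v)(b)/(c), uniqueness of the two factorisations of a pre-step, for `C^birat` (`C`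
isotropic): all four factors are isomorphisms. [cite: MochizukiFrdI2008, Def. 1.3 (v) p.25] -/
theorem birat_v_unique (hiso : IsOfIsotropicType F) {A B X X' : Birat F hF hsq} (φ : A ⟶ B)
    (β : A ⟶ X) (α : X ⟶ B) (β' : A ⟶ X') (α' : X' ⟶ B) (h : β ≫ α = φ)
    (hβ : IsPreStep (toElemZero hF hsq) β) (h' : β' ≫ α' = φ)
    (hβ' : IsPreStep (toElemZero hF hsq) β') :
    ∃ γ : X ≅ X', β ≫ γ.hom = β' ∧ α = γ.hom ≫ α' := by
  haveI : IsIso β := isIso_of_isPreStep hiso β hβ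
  haveI : IsIso β' := isIso_of_isPreStep hiso β' hβ'
  refine ⟨(asIso β).symm ≪≫ asIso β', by simp, ?_⟩
  change α = (inv β ≫ β') ≫ α'
  rw [Category.assoc, h', ← h, IsIso.inv_hom_id_assoc]

/-- Def. 1.3 (vi) for `C^birat` (`C` isotropic): two invertible base-equivalent `φ, ψ : A → B` differ
by `ψ⁻¹ ≫ φ ∈ O^×(B)`. [cite: MochizukiFrdI2008, Def. 1.3 (vi) p.25] -/
theorem birat_vi (hiso : IsOfIsotropicType F) {A B : Birat F hF hsq} (φ ψ : A ⟶ B)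
    (hφ : IsCoAngularPreStep (toElemZero hF hsq) φ) (hψ : IsCoAngularPreStep (toElemZero hF hsq) ψ)
    (hb : BaseEquivalent (toElemZero hF hsq) φ ψ) :
    ∃ α ∈ unitsSubgroup (toElemZero hF hsq) B, ψ ≫ α.hom = φ := by
  haveI : IsIso φ := (isCoAngularPreStep_iff_isIso hiso φ).mp hφ
  haveI : IsIso ψ := (isCoAngularPreStep_iff_isIso hiso ψ).mp hψ
  have hb' : Base (toElemZero hF hsq) φ = Base (toElemZero hF hsq) ψ := hb
  refine ⟨(asIso ψ).symm ≪≫ asIso φ, ⟨?_, ?_⟩, by simp⟩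
  · change Base (toElemZero hF hsq) (inv ψ ≫ φ) = 𝟙 _
    rw [base_comp, hb', ← base_comp, IsIso.inv_hom_id, base_id]
  · change degFr (toElemZero hF hsq) (inv ψ ≫ φ) = 1
    rw [degFr_comp, show degFr (toElemZero hF hsq) (inv ψ) = 1 from isLinear_of_isIso _ _,
      show degFr (toElemZero hF hsq) φ = 1 from isLinear_of_isIso _ _, mul_one]

/-- Def. 1.3 (vii)(a) for `C^birat` (`C` isotropic): every object is isotropic, so the identity is an
isotropic hull. [cite: MochizukiFrdI2008, Def. 1.3 (vii) p.25] -/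
theorem birat_vii_a (hiso : IsOfIsotropicType F) (A : Birat F hF hsq) :
    ∃ (B : Birat F hF hsq) (φ : A ⟶ B), IsIsotropicHull (toElemZero hF hsq) φ :=
  ⟨A, 𝟙 A, isIsometry_toElemZero _, isPreStep_of_isIso _ _, isIsotropic hiso A,
    fun _ γ _ => ⟨γ, Category.id_comp γ, fun β hβ => by rw [← hβ, Category.id_comp]⟩⟩

/-! ### The theorem -/

/-- **[FrdI] Proposition 4.4 (ii), in the author's corrected 2024 form (comments (29)(i)), ISOTROPIC CASE:
for a Frobenioid `C → F_Φ` of isotropic and birationally Frobenius-normalized type, the pre-Frobenioid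
`C^birat → F_{0_D}` IS A FROBENIOID** (Def. 1.3 (i)–(vii) verified for THE birationalization
`Birat F hF hsq`). Hypotheses: `hiso` = "`C` is of isotropic type" (the case `C^istr` / the reduced case
of Cor. 4.11; print's general non-isotropic case is not treated here), `hbfn` = "`C` is of birationally
Frobenius-normalized type" (Def. 4.5 (i), abc-iut-L6-t8's `IsBiratFrobeniusNormalized`, the hypothesis
added by the author in 2024 — used exactly for Def. 1.3 (iii)(c), via `endSubmonoid_comm`).
[cite: MochizukiFrdI2008, Prop. 4.4 (ii) p.83] -/
theorem isFrobenioid (hF : IsFrobenioid F) (hsq : HasBiratSquares F) (hiso : IsOfIsotropicType F)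
    (hbfn : ∀ A : C, IsBiratFrobeniusNormalized F hF hsq A) : IsFrobenioid (toElemZero hF hsq) where
  isPreFrobenioid := isPreFrobenioid hF hsq
  i_a := i_a hiso
  i_b := i_b
  i_c := i_c
  ii_exists := ii_exists hiso
  ii_unique := ii_unique hiso
  iii_a := fun _ _ _ f g _ _ => isCoAngular hiso (f ≫ g)
  iii_b := fun _ _ _ _ ψ => isCoAngular hiso ψ
  iii_c := fun _ _ φ hφ => birat_iii_c hiso φ hφ
  iii_c_base := fun _ _ φ φ' hφ hφ' hb α β β' h h' =>
    birat_iii_c_base hiso hbfn φ φ' hφ hφ' hb α β β' h h'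
  iii_d_under_full := fun _ _ _ φ φ' hφ hφ' _ => birat_iii_d_under_full hiso φ φ' hφ hφ'
  iii_d_under_surj := fun A _ =>
    ⟨A, 𝟙 A, (isCoAngularPreStep_iff_isIso hiso _).mpr inferInstance, rfl⟩
  iii_d_over_full := fun _ _ _ ψ ψ' h h' _ => birat_iii_d_over_full hiso ψ ψ' h h'
  iii_d_over_surj := fun A _ =>
    ⟨A, 𝟙 A, (isCoAngularPreStep_iff_isIso hiso _).mpr inferInstance, rfl⟩
  iv_a_exists := iv_a_exists hiso
  iv_a_unique := iv_a_unique hiso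
  iv_b := iv_b hiso
  v_a := fun _ _ φ hφ => by
    haveI := isIso_of_isPreStep hiso φ hφ
    infer_instance
  v_b_exists := fun _ B φ hφ =>
    ⟨B, φ, 𝟙 B, Category.comp_id φ, ⟨isCoAngular hiso φ, hφ⟩, isIsometry_toElemZero _,
      isPreStep_of_isIso _ _⟩
  v_b_unique := fun _ _ _ _ φ β α β' α' h hβ _ h' hβ' _ =>
    birat_v_unique hiso φ β α β' α' h hβ.2 h' hβ'.2
  v_c_exists := fun A _ φ hφ =>
    ⟨A, 𝟙 A, φ, Category.id_comp φ, ⟨isIsometry_toElemZero _, isPreStep_of_isIso _ _⟩,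
      ⟨isCoAngular hiso φ, hφ⟩⟩
  v_c_unique := fun _ _ _ _ φ β α β' α' h hβ _ h' hβ' _ =>
    birat_v_unique hiso φ β α β' α' h hβ.2 h' hβ'.2
  vi := fun _ _ φ ψ hφ hψ hb _ => birat_vi hiso φ ψ hφ hψ hb
  vii_a := birat_vii_a hiso
  vii_b := fun _ B _ _ => isIsotropic hiso B

/-- **[FrdI] Prop. 4.4 (ii) (2024 form), isotropic case, for every Frobenioid of isotropic and
birationally Frobenius-normalized type** — the square-completion hypothesis `HasBiratSquares` of the
construction of `C^birat` being Prop. 1.11 (vii), discharged for every Frobenioid by abc-iut-L6-t6's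
`hasBiratSquares_of_isFrobenioid`. [cite: MochizukiFrdI2008, Prop. 4.4 (ii) p.83] -/
theorem isFrobenioid_of_isFrobenioid (hF : IsFrobenioid F) (hiso : IsOfIsotropicType F)
    (hbfn : ∀ A : C, IsBiratFrobeniusNormalized F hF (hasBiratSquares_of_isFrobenioid hF) A) :
    IsFrobenioid (toElemZero hF (hasBiratSquares_of_isFrobenioid hF)) :=
  isFrobenioid hF _ hiso hbfn

/-- **[FrdI] Prop. 4.4 (ii) (2024 form) for Frobenioids of isotropic and MODEL type** (Def. 4.5 (i):
model type = pre-model ∧ birationally Frobenius-normalized type, abc-iut-L6-t8's `IsOfModelType`): their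
birationalization `C^birat → F_{0_D}` is a Frobenioid. [cite: MochizukiFrdI2008, Prop. 4.4 (ii) p.83] -/
theorem isFrobenioid_of_isOfModelType (hF : IsFrobenioid F) (hsq : HasBiratSquares F)
    (hiso : IsOfIsotropicType F) (hmod : IsOfModelType F hF hsq) : IsFrobenioid (toElemZero hF hsq) :=
  isFrobenioid hF hsq hiso hmod.2

end Birat

end PreFrobenioid

end Literature.AlgebraicGeometry.Frobenioids
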